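import Literature.Algebra.Homology.DiscreteRepLayerColimitBounded
import HarnessLib

/-!
# `Hⁿ_cont(Γ, M)` is finite of order `≤ B` when a COFINAL family of layers `Hⁿ(Γ⧸W, M^W)` has at most `B` elements;
# in degree `1` the transitions `H¹(Γ⧸U, M^U) → H¹(Γ⧸V, M^V)` are injective (Serre I §2.2 Prop. 8)

Topic `Algebra/Homology`; namespace `Literature.Algebra.Homology.DiscreteRep.LayerColimit`.  THEOREMS ONLY
(no definition, no named fact, no `sorry`, no instance; D-0026).  Sequel of `DiscreteRepLayerColimitBounded`
(`finsetCard_ext_le_of_layers`, …: the bound is asked at EVERY open normal `U ≤ Γ`) and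
`DiscreteRepLayerColimitGroupCohomology` (`stepG`, `inflG`, `inflG_stepG`, `inflG_injective_one`, `exists_inflG_eq`).

* §1 `stepG_injective_one`: `stepG U V : H¹(Γ⧸U, M^U) → H¹(Γ⧸V, M^V)` (`V ≤ U`) is injective — both layers inflate
  injectively into `Ext¹_{C_Γ}(k, M)` in degree `1` (inflation–restriction) and the inflations are compatible with
  the transitions; hence a bound on the finite subsets of `H¹(Γ⧸V, M^V)` is a bound on those of `H¹(Γ⧸U, M^U)`
  (`finsetCard_le_of_stepG_one`).
* §2 the COFINAL form of the boundedness theorems, every degree: if every open normal `U` contains an open normal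
  `W` all of whose finite subsets of `Hⁿ(Γ⧸W, M^W)` have at most `B` elements, then every finite subset of
  `Extⁿ_{C_Γ}(k, M)` / `Hⁿ_cont(Γ, X)` has at most `B` elements, so the limit group is finite with `Nat.card ≤ B`
  (`finsetCard_ext_le_of_cofinal_layers`, `finite_ext_of_cofinal_layers`, `natCard_ext_le_of_cofinal_layers`,
  `finsetCard_continuousCohomology_le_of_cofinal_layers`, `finite_continuousCohomology_of_cofinal_layers`,
  `natCard_continuousCohomology_le_of_cofinal_layers`).  Proof as in the file sequel-ed: finitely many classes come
  from ONE common open normal `U₀` (directedness), below which the hypothesis supplies a bounded layer `W ≤ U₀`; push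
  the classes to `W` (injectively, since inflating back recovers them).

Written for lane «TATE-EPC-TC» of cell `bsd-eis` (crux `GoodLatticeBDPValue`, stmt-BirchSwinnertonDyer-19032; brick (F1b):
the layers of `H¹(U, E_S)` that one reads — `H¹(Gal(E/F₀), 𝒪_{E,S}ˣ)` for `E/K` finite GALOIS — are only cofinal among
the open normal subgroups of `U`).

## References
* J.-P. Serre, *Cohomologie galoisienne* (1994), I §2.2 Prop. 8. [SerreGaloisCohomology1997]
* J. Neukirch, A. Schmidt, K. Wingberg, *Cohomology of Number Fields*, 2nd ed. (2008), (1.5.1), (1.6.7).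
  [NeukirchSchmidtWingberg2008]
* D. Harari, *Galois Cohomology and Class Field Theory* (2020), Prop. 4.18, Remark 4.24. [Harari2020]
-/

noncomputable section

namespace Literature.Algebra.Homology

namespace DiscreteRep

namespace LayerColimit

open CategoryTheory CategoryTheory.Limits CategoryTheory.Abelian

universe u

variable {k Γ : Type u} [CommRing k] [Group Γ] [TopologicalSpace Γ] [IsTopologicalGroup Γ]

/-! ### §1 Degree one: the transitions are injective -/

/-- **In degree `1` the transition `stepG U V : H¹(Γ⧸U, M^U) → H¹(Γ⧸V, M^V)` is injective** (`V ≤ U` open normal):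
`inflG V ∘ stepG U V = inflG U` and `inflG U` is injective in degree `1`.
[cite: SerreGaloisCohomology1997, I §2.2 Prop. 8] [cite: NeukirchSchmidtWingberg2008, (1.6.7)] -/
theorem stepG_injective_one (U V : OpenNormalSubgroup Γ) (h : (V : Subgroup Γ) ≤ U) (M : DiscreteRepCat k Γ) :
    Function.Injective (stepG U V h M 1) := fun c c' hcc' => by
  apply inflG_injective_one M U
  rw [← inflG_stepG U V h M 1 c, ← inflG_stepG U V h M 1 c', hcc']

/-- In degree `1`, a bound on the finite subsets of the deeper layer `H¹(Γ⧸V, M^V)` bounds the finite subsets of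
`H¹(Γ⧸U, M^U)` (`V ≤ U`). [cite: SerreGaloisCohomology1997, I §2.2 Prop. 8] -/
theorem finsetCard_le_of_stepG_one (U V : OpenNormalSubgroup Γ) (h : (V : Subgroup Γ) ≤ U) (M : DiscreteRepCat k Γ)
    {B : ℕ} (hB : ∀ t : Finset (groupCohomology ((invariantsQuotFunctor k (V : Subgroup Γ)).obj M) 1), t.card ≤ B)
    (t : Finset (groupCohomology ((invariantsQuotFunctor k (U : Subgroup Γ)).obj M) 1)) : t.card ≤ B := by
  classical
  calc t.card = (t.image (stepG U V h M 1)).card :=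
      (Finset.card_image_of_injective _ (stepG_injective_one U V h M)).symm
    _ ≤ B := hB _

/-! ### §2 Bounded cofinal layers, every degree -/

variable [CompactSpace Γ] [TotallyDisconnectedSpace Γ]

/-- **Finitely many classes of `Extⁿ_{C_Γ}(k, M)` come injectively from one BOUNDED layer**: if every open normal
`U` contains an open normal `W` whose finite subsets of `Hⁿ(Γ⧸W, M^W)` have at most `B` elements, then every finite
subset of `Extⁿ_{C_Γ}(k, M)` has at most `B` elements.
[cite: SerreGaloisCohomology1997, I §2.2 Prop. 8] [cite: NeukirchSchmidtWingberg2008, (1.5.1)] -/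
theorem finsetCard_ext_le_of_cofinal_layers (n : ℕ) (M : DiscreteRepCat k Γ) (B : ℕ)
    (h : ∀ U : OpenNormalSubgroup Γ, ∃ W : OpenNormalSubgroup Γ, (W : Subgroup Γ) ≤ U ∧
      ∀ t : Finset (groupCohomology ((invariantsQuotFunctor k (W : Subgroup Γ)).obj M) n), t.card ≤ B)
    (s : Finset (Ext (triv (Γ := Γ) k) M n)) : s.card ≤ B := by
  classical
  -- each class is inflated from some layer
  choose U c hc using fun x : Ext (triv (Γ := Γ) k) M n => exists_inflG_eq n M x
  -- a common refinement `U₀` of the layers of the classes in `s`, and a bounded layer `W ≤ U₀`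
  obtain ⟨U₀, hU₀⟩ := exists_openNormalSubgroup_le_of_finset s U ⟨⊤, by simp⟩
  obtain ⟨W, hWU₀, hW⟩ := h U₀
  -- push the chosen layer classes to `W`
  let f : {x // x ∈ s} → groupCohomology ((invariantsQuotFunctor k (W : Subgroup Γ)).obj M) n :=
    fun x => stepG (U x.1) W (hWU₀.trans (hU₀ x.1 x.2)) M n (c x.1)
  have hf : ∀ x : {x // x ∈ s}, inflG W M n (f x) = x.1 := fun x => by
    simp only [f, inflG_stepG, hc]
  have hinj : Function.Injective f := fun x y hxy => Subtype.ext (by rw [← hf x, ← hf y, hxy])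
  calc s.card = s.attach.card := Finset.card_attach.symm
    _ = (s.attach.image f).card := (Finset.card_image_of_injective _ hinj).symm
    _ ≤ B := hW _

/-- **`Extⁿ_{C_Γ}(k, M)` is finite** when a cofinal family of layers is uniformly bounded.
[cite: SerreGaloisCohomology1997, I §2.2 Prop. 8] -/
theorem finite_ext_of_cofinal_layers (n : ℕ) (M : DiscreteRepCat k Γ) (B : ℕ)
    (h : ∀ U : OpenNormalSubgroup Γ, ∃ W : OpenNormalSubgroup Γ, (W : Subgroup Γ) ≤ U ∧
      ∀ t : Finset (groupCohomology ((invariantsQuotFunctor k (W : Subgroup Γ)).obj M) n), t.card ≤ B) :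
    Finite (Ext (triv (Γ := Γ) k) M n) := by
  by_contra hinf
  rw [not_finite_iff_infinite] at hinf
  obtain ⟨s, hs⟩ := Infinite.exists_subset_card_eq (Ext (triv (Γ := Γ) k) M n) (B + 1)
  have := finsetCard_ext_le_of_cofinal_layers n M B h s
  omega

/-- **`#Extⁿ_{C_Γ}(k, M) ≤ B`** when a cofinal family of layers has finite subsets of size `≤ B`.
[cite: SerreGaloisCohomology1997, I §2.2 Prop. 8] -/
theorem natCard_ext_le_of_cofinal_layers (n : ℕ) (M : DiscreteRepCat k Γ) (B : ℕ)
    (h : ∀ U : OpenNormalSubgroup Γ, ∃ W : OpenNormalSubgroup Γ, (W : Subgroup Γ) ≤ U ∧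
      ∀ t : Finset (groupCohomology ((invariantsQuotFunctor k (W : Subgroup Γ)).obj M) n), t.card ≤ B) :
    Nat.card (Ext (triv (Γ := Γ) k) M n) ≤ B := by
  classical
  haveI := finite_ext_of_cofinal_layers n M B h
  haveI := Fintype.ofFinite (Ext (triv (Γ := Γ) k) M n)
  rw [Nat.card_eq_fintype_card, ← Finset.card_univ]
  exact finsetCard_ext_le_of_cofinal_layers n M B h _

variable [TopologicalSpace k]

open TopRep in
/-- **Finitely many classes of `Hⁿ_cont(Γ, X)` come injectively from one bounded layer** (transport of
`finsetCard_ext_le_of_cofinal_layers` along `Φ : Extⁿ_{C_Γ}(k, X) ≃+ Hⁿ_cont(Γ, X)`).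
[cite: SerreGaloisCohomology1997, I §2.2 Prop. 8] [cite: Harari2020, Prop. 4.18, Remark 4.24] -/
theorem finsetCard_continuousCohomology_le_of_cofinal_layers (X : TopRep.{u} k Γ) [DiscreteTopology X.V]
    (hX : IsDiscrete ((forgetTop k Γ).obj X)) (n B : ℕ)
    (h : ∀ U : OpenNormalSubgroup Γ, ∃ W : OpenNormalSubgroup Γ, (W : Subgroup Γ) ≤ U ∧
      ∀ t : Finset (groupCohomology ((invariantsQuotFunctor k (W : Subgroup Γ)).obj (stdBase X hX)) n),
        t.card ≤ B)
    (s : Finset (continuousCohomology n X : TopModuleCat.{u} k)) : s.card ≤ B := by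
  classical
  let Φ := extTrivAddEquivContinuousCohomology X hX n
  calc s.card = (s.image Φ.symm).card := (Finset.card_image_of_injective _ Φ.symm.injective).symm
    _ ≤ B := finsetCard_ext_le_of_cofinal_layers n (stdBase X hX) B h _

open TopRep in
/-- **`Hⁿ_cont(Γ, X)` is finite** when a cofinal family of its layers `Hⁿ(Γ⧸W, X^W)` is uniformly bounded.
[cite: SerreGaloisCohomology1997, I §2.2 Prop. 8] [cite: Harari2020, Prop. 4.18, Remark 4.24] -/
theorem finite_continuousCohomology_of_cofinal_layers (X : TopRep.{u} k Γ) [DiscreteTopology X.V]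
    (hX : IsDiscrete ((forgetTop k Γ).obj X)) (n B : ℕ)
    (h : ∀ U : OpenNormalSubgroup Γ, ∃ W : OpenNormalSubgroup Γ, (W : Subgroup Γ) ≤ U ∧
      ∀ t : Finset (groupCohomology ((invariantsQuotFunctor k (W : Subgroup Γ)).obj (stdBase X hX)) n),
        t.card ≤ B) :
    Finite (continuousCohomology n X : TopModuleCat.{u} k) := by
  by_contra hinf
  rw [not_finite_iff_infinite] at hinf
  obtain ⟨s, hs⟩ := Infinite.exists_subset_card_eq (continuousCohomology n X : TopModuleCat.{u} k) (B + 1)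
  have := finsetCard_continuousCohomology_le_of_cofinal_layers X hX n B h s
  omega

open TopRep in
/-- **`#Hⁿ_cont(Γ, X) ≤ B`** when a cofinal family of its layers has finite subsets of size `≤ B`.
[cite: SerreGaloisCohomology1997, I §2.2 Prop. 8] [cite: Harari2020, Prop. 4.18, Remark 4.24] -/
theorem natCard_continuousCohomology_le_of_cofinal_layers (X : TopRep.{u} k Γ) [DiscreteTopology X.V]
    (hX : IsDiscrete ((forgetTop k Γ).obj X)) (n B : ℕ)
    (h : ∀ U : OpenNormalSubgroup Γ, ∃ W : OpenNormalSubgroup Γ, (W : Subgroup Γ) ≤ U ∧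
      ∀ t : Finset (groupCohomology ((invariantsQuotFunctor k (W : Subgroup Γ)).obj (stdBase X hX)) n),
        t.card ≤ B) :
    Nat.card (continuousCohomology n X : TopModuleCat.{u} k) ≤ B := by
  classical
  haveI := finite_continuousCohomology_of_cofinal_layers X hX n B h
  haveI := Fintype.ofFinite (continuousCohomology n X : TopModuleCat.{u} k)
  rw [Nat.card_eq_fintype_card, ← Finset.card_univ]
  exact finsetCard_continuousCohomology_le_of_cofinal_layers X hX n B h _

end LayerColimit

end DiscreteRep

end Literature.Algebra.Homology

end
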